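import Mathlib
import HarnessLib
import Summits.Ventures.LatticeQCDFlow.Exactness.SU2ResidualExactForceVolumeUniform
import Summits.Ventures.LatticeQCDFlow.Exactness.SU2ExactForceVolumeUniformParity

/-!
# The learned `SU(2)` residual member, one trajectory-length threshold for every volume: UNIQUENESS of the invariant law, and the PARITY-MASKED family on EVERY even torus

HONEST FRAMING: exact (Metropolis-corrected) sampling algorithms for lattice gauge theory;
figures of merit are autocorrelation/cost numbers at stated couplings and volumes; no
continuum-physics claim.

Venture `LatticeQCDFlow` (cell pub-lqcd), topic `Exactness`; FANOUT row 14 (`eng-flowhmc`, engine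
`latflow.fthmc`, family B: FT-HMC through the LEARNED residual member `maps.residual_trained_scan` on
`SU(2)` with the exact autodiff force, row 9's `n`-step kernel `su2LeapfrogHMCN`; acceptance
configuration `examples/su2_4d_L4_fthmc.json`: 4⁴, parity masks).  NEW WORK of the cell over the tree
(`SU2ResidualExactForceVolumeUniform`: volume-free `Φ_max`, `K_Φ`, `τ₀` for ONE conditioner evaluated on
every torus; `SU2ExactForceVolumeUniformParity`: uniqueness in trajectory-length form with the threshold
chosen before the link set, `su2LeapfrogFTHMCN_invariant_unique_of_trajLength_uniform`;
`SU2ResidualExactForceFTHMCN`: the learned-member package; `SU2LeapfrogHMCWilson`); nothing is cited as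
a fact; no number.  Sixth file of the GEN-16 programme (the twin of GEN-15's V6 for the learned member).
Hypotheses on the weight family `ρF M` exactly as in `SU2ResidualExactForceVolumeUniform`: (ρN), (ρT),
(ρL) receptive radius `m`, (ρD), (ρC), (ρm), (ρloc), (ρκ).

* §1 **`wilsonMeasure_unique_invariant_su2Residual_member_fthmcN_exactForce_allVolumes`** — with the
  SAME kind of volume-free `τ₀`: for every side `L` (`w ∣ L`), `n ≥ 1`, `ε' > 0`, `nε' ≤ τ₀`,
  `wilsonMeasure SU(2).subtype β` is the ONLY invariant probability law of the reported `n`-step kernel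
  through the learned member with the exact force as run;
* §2 **`su2Residual_fthmcN_parityLattice_exactForce_uniformlyErgodic_allEvenSides`** — parity masks
  `Σxᵢ mod 2` (classes `bf s : ZMod 2`), any `d`, any schedule: ONE `τ₀` such that on EVERY even torus
  the reported `n`-step FT-HMC kernel through the learned member (`nε' ≤ τ₀`) converges to the Wilson
  measure from every start — the row's 4⁴ acceptance lattice and every larger even volume share `τ₀`.

NOT CLAIMED: the value of `τ₀`; a volume-uniform rate; that a given trained network meets the
hypotheses (per-volume retrained weights: nothing follows); longer trajectories; OMF; floating point.
-/

noncomputable section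

namespace Summit.Ventures.LatticeQCDFlow.Exactness

open Set Function MeasureTheory ProbabilityTheory ProbabilityTheory.Kernel InnerProductGeometry WithLp NormedSpace
open Literature.MathematicalPhysics.QuantumFieldTheory
open Literature.MathematicalPhysics.QuantumFieldTheory.Balaban1983to89.B10Eq18SigmaSU2Haar (expPauli)
open scoped ENNReal Matrix Matrix.Norms.Operator NNReal

set_option backward.isDefEq.respectTransparency false

/-! ## §1 Uniqueness of the invariant law for the learned member, one threshold for every volume -/

section Unique

variable {d : ℕ} {σ : Type*}

/-- **THE WILSON MEASURE IS THE UNIQUE INVARIANT LAW OF FT-HMC THROUGH THE LEARNED MEMBER, ONE THRESHOLD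
FOR EVERY VOLUME.**  Phase masks of width `w > 1`, ANY schedule, one conditioner on every torus
((ρN)…(ρκ)), every `β, κ, κ' > 0`: there is `τ₀ > 0` such that for EVERY side `L` with `w ∣ L` there are
`layers` (VERBATIM, weights `ρF L`) with measurable exact force, and for every `n ≥ 1`, `ε' > 0`,
`nε' ≤ τ₀`, `wilsonMeasure SU(2).subtype β` is the ONLY invariant probability law of the reported
`n`-step kernel with the exact force as run. -/
theorem wilsonMeasure_unique_invariant_su2Residual_member_fthmcN_exactForce_allVolumes (w : ℕ) [Fact (1 < w)]
    (μf : σ → Fin d) (bf : σ → ZMod w) (cf : σ → ℝ)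
    (ρF : ∀ M : ℕ, σ → GaugeConfig d M (Matrix.specialUnitaryGroup (Fin 2) ℂ) → Edge d M → Fin d → Fin 2 → ℝ) (m : ℕ)
    (hρN : (∀ (M M' : ℕ) (hwM : w ∣ M) (hMM : M ∣ M') (s : σ) (V : GaugeConfig d M (Matrix.specialUnitaryGroup (Fin 2) ℂ)) (e : Edge d M') (ν : Fin d) (t : Fin 2),
      ρF M' s (fun e : Edge d M' => V (fun i => ZMod.castHom hMM (ZMod M) (e.1 i), e.2)) e ν t =
        ρF M s V ((fun j => ZMod.castHom hMM (ZMod M) (e.1 j)), e.2) ν t))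
    (hρT : (∀ (M : ℕ) (hwM : w ∣ M) (t : Site d M), (∀ x : Site d M, ZMod.castHom hwM (ZMod w) (∑ j, (x + t) j) = ZMod.castHom hwM (ZMod w) (∑ j, x j)) →
      ∀ (s : σ) (W : GaugeConfig d M (Matrix.specialUnitaryGroup (Fin 2) ℂ)) (e : Edge d M) (ν : Fin d) (b : Fin 2),
      ρF M s (fun e : Edge d M => W (e.1 + t, e.2)) e ν b = ρF M s W (e.1 + t, e.2) ν b))
    (hρL : (∀ (M : ℕ) (s : σ) (U U' : GaugeConfig d M (Matrix.specialUnitaryGroup (Fin 2) ℂ)) (x : Site d M) (r : ℕ),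
      (∀ e : Edge d M, (∃ z : Fin d → ℤ, (∀ i, |z i| ≤ (((r+m+1) : ℕ) : ℤ)) ∧ e.1 = x + fun i => ((z i : ℤ) : ZMod M)) → U e = U' e) →
      ∀ e : Edge d M, (∃ z : Fin d → ℤ, (∀ i, |z i| ≤ ((r : ℕ) : ℤ)) ∧ e.1 = x + fun i => ((z i : ℤ) : ZMod M)) → ∀ (ν : Fin d) (t : Fin 2), ρF M s U e ν t = ρF M s U' e ν t))
    (hρD : (∀ (M : ℕ) [NeZero M] (s : σ) (U : (Edge d M → EuclideanSpace ℝ (Fin 3)) → GaugeConfig d M (Matrix.specialUnitaryGroup (Fin 2) ℂ))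
      (p₀ : Edge d M → EuclideanSpace ℝ (Fin 3)),
      (∀ e : Edge d M, DifferentiableAt ℝ (fun p => ((U p e : (Matrix.specialUnitaryGroup (Fin 2) ℂ)) : Matrix (Fin 2) (Fin 2) ℂ)) p₀) →
      ∀ (e : Edge d M) (ν : Fin d) (b : Fin 2), DifferentiableAt ℝ (fun p => ρF M s (U p) e ν b) p₀))
    (hρC : (∀ (M : ℕ) [NeZero M] {n : WithTop ℕ∞} (s : σ) (U : (Edge d M → Matrix (Fin 2) (Fin 2) ℂ) × (Edge d M → EuclideanSpace ℝ (Fin 3)) → GaugeConfig d M (Matrix.specialUnitaryGroup (Fin 2) ℂ)) (p₀ : (Edge d M → Matrix (Fin 2) (Fin 2) ℂ) × (Edge d M → EuclideanSpace ℝ (Fin 3))),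
      (∀ e : Edge d M, ContDiffAt ℝ n (fun p : (Edge d M → Matrix (Fin 2) (Fin 2) ℂ) × (Edge d M → EuclideanSpace ℝ (Fin 3)) => ((U p e : (Matrix.specialUnitaryGroup (Fin 2) ℂ)) : Matrix (Fin 2) (Fin 2) ℂ)) p₀) →
      ∀ (e : Edge d M) (ν : Fin d) (b : Fin 2), ContDiffAt ℝ n (fun p : (Edge d M → Matrix (Fin 2) (Fin 2) ℂ) × (Edge d M → EuclideanSpace ℝ (Fin 3)) => ρF M s (U p) e ν b) p₀))
    (hρm : (∀ (M : ℕ) (s : σ) (e : Edge d M) (ν : Fin d) (t : Fin 2), Measurable fun V : GaugeConfig d M (Matrix.specialUnitaryGroup (Fin 2) ℂ) => ρF M s V e ν t))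
    (hρloc : (∀ (M : ℕ) (hwM : w ∣ M) (s : σ) (V W : GaugeConfig d M (Matrix.specialUnitaryGroup (Fin 2) ℂ)),
      (∀ j : Edge d M, ¬(j.2 = μf s ∧ ZMod.castHom hwM (ZMod w) (∑ i, j.1 i) = bf s) → V j = W j) →
        ∀ e : Edge d M, (e.2 = μf s ∧ ZMod.castHom hwM (ZMod w) (∑ i, e.1 i) = bf s) → ∀ (ν : Fin d) (t : Fin 2), ρF M s V e ν t = ρF M s W e ν t))
    {κ₀ : ℝ} (hκ0 : 0 ≤ κ₀) (hκ₀ : κ₀ < 1) (hκ : (∀ (M : ℕ) (hwM : w ∣ M) (s : σ) (V : GaugeConfig d M (Matrix.specialUnitaryGroup (Fin 2) ℂ)) (e : Edge d M), (e.2 = μf s ∧ ZMod.castHom hwM (ZMod w) (∑ i, e.1 i) = bf s) →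
      |cf s| * ∑ ν ∈ Finset.univ.erase e.2, (|ρF M s V e ν 0| + |ρF M s V e ν 1|) ≤ κ₀))
    (sched : List σ) (β κ : ℝ) {κ' : ℝ} (hκ' : 0 < κ') :
    ∃ τ₀ : ℝ, 0 < τ₀ ∧ ∀ (L : ℕ) [NeZero L] (hwL : w ∣ L),
    ∃ layers : List ((GaugeConfig d L (Matrix.specialUnitaryGroup (Fin 2) ℂ) ≃ᵐ GaugeConfig d L (Matrix.specialUnitaryGroup (Fin 2) ℂ)) × (GaugeConfig d L (Matrix.specialUnitaryGroup (Fin 2) ℂ) → ℝ)),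
      layers.map (fun Ly => ((Ly.1 : GaugeConfig d L (Matrix.specialUnitaryGroup (Fin 2) ℂ) → GaugeConfig d L (Matrix.specialUnitaryGroup (Fin 2) ℂ)), Ly.2)) =
        sched.map (fun s =>
          ((fun (V : GaugeConfig d L (Matrix.specialUnitaryGroup (Fin 2) ℂ)) (e : Edge d L) =>
        if e.2 = μf s ∧ (ZMod.castHom hwL (ZMod w) (∑ j, e.1 j)) = bf s then
          gaussUnit (geodesicKick (cf s) (∑ ν ∈ Finset.univ.erase e.2,
            (ρF L s V e ν 0 • vecQuat (((V (Site.shift e.1 e.2, ν) * (V (Site.shift e.1 ν, e.2))⁻¹ * (V (e.1, ν))⁻¹)⁻¹ : Matrix.specialUnitaryGroup (Fin 2) ℂ) : Matrix (Fin 2) (Fin 2) ℂ) +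
              ρF L s V e ν 1 • vecQuat ((((V (Site.shift (e.1 - Pi.single ν 1) e.2, ν))⁻¹ * (V (e.1 - Pi.single ν 1, e.2))⁻¹ * V (e.1 - Pi.single ν 1, ν))⁻¹ : Matrix.specialUnitaryGroup (Fin 2) ℂ) : Matrix (Fin 2) (Fin 2) ℂ)))
            (vecQuat ((V e : Matrix.specialUnitaryGroup (Fin 2) ℂ) : Matrix (Fin 2) (Fin 2) ℂ)))
        else V e),
           fun V : GaugeConfig d L (Matrix.specialUnitaryGroup (Fin 2) ℂ) => ∏ a : {e : Edge d L // e.2 = μf s ∧ (ZMod.castHom hwL (ZMod w) (∑ j, e.1 j)) = bf s},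
          (if Real.sin (angle (∑ ν ∈ Finset.univ.erase a.1.2,
            (ρF L s V a.1 ν 0 • vecQuat (((V (Site.shift a.1.1 a.1.2, ν) * (V (Site.shift a.1.1 ν, a.1.2))⁻¹ * (V (a.1.1, ν))⁻¹)⁻¹ : Matrix.specialUnitaryGroup (Fin 2) ℂ) : Matrix (Fin 2) (Fin 2) ℂ) +
              ρF L s V a.1 ν 1 • vecQuat ((((V (Site.shift (a.1.1 - Pi.single ν 1) a.1.2, ν))⁻¹ * (V (a.1.1 - Pi.single ν 1, a.1.2))⁻¹ * V (a.1.1 - Pi.single ν 1, ν))⁻¹ : Matrix.specialUnitaryGroup (Fin 2) ℂ) : Matrix (Fin 2) (Fin 2) ℂ))) (vecQuat ((V a.1 : Matrix.specialUnitaryGroup (Fin 2) ℂ) : Matrix (Fin 2) (Fin 2) ℂ))) = 0 then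
            (1 - cf s * ‖(∑ ν ∈ Finset.univ.erase a.1.2,
            (ρF L s V a.1 ν 0 • vecQuat (((V (Site.shift a.1.1 a.1.2, ν) * (V (Site.shift a.1.1 ν, a.1.2))⁻¹ * (V (a.1.1, ν))⁻¹)⁻¹ : Matrix.specialUnitaryGroup (Fin 2) ℂ) : Matrix (Fin 2) (Fin 2) ℂ) +
              ρF L s V a.1 ν 1 • vecQuat ((((V (Site.shift (a.1.1 - Pi.single ν 1) a.1.2, ν))⁻¹ * (V (a.1.1 - Pi.single ν 1, a.1.2))⁻¹ * V (a.1.1 - Pi.single ν 1, ν))⁻¹ : Matrix.specialUnitaryGroup (Fin 2) ℂ) : Matrix (Fin 2) (Fin 2) ℂ)))‖ * Real.cos (angle (∑ ν ∈ Finset.univ.erase a.1.2,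
            (ρF L s V a.1 ν 0 • vecQuat (((V (Site.shift a.1.1 a.1.2, ν) * (V (Site.shift a.1.1 ν, a.1.2))⁻¹ * (V (a.1.1, ν))⁻¹)⁻¹ : Matrix.specialUnitaryGroup (Fin 2) ℂ) : Matrix (Fin 2) (Fin 2) ℂ) +
              ρF L s V a.1 ν 1 • vecQuat ((((V (Site.shift (a.1.1 - Pi.single ν 1) a.1.2, ν))⁻¹ * (V (a.1.1 - Pi.single ν 1, a.1.2))⁻¹ * V (a.1.1 - Pi.single ν 1, ν))⁻¹ : Matrix.specialUnitaryGroup (Fin 2) ℂ) : Matrix (Fin 2) (Fin 2) ℂ))) (vecQuat ((V a.1 : Matrix.specialUnitaryGroup (Fin 2) ℂ) : Matrix (Fin 2) (Fin 2) ℂ)))) ^ 3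
          else kickJac (cf s * ‖(∑ ν ∈ Finset.univ.erase a.1.2,
            (ρF L s V a.1 ν 0 • vecQuat (((V (Site.shift a.1.1 a.1.2, ν) * (V (Site.shift a.1.1 ν, a.1.2))⁻¹ * (V (a.1.1, ν))⁻¹)⁻¹ : Matrix.specialUnitaryGroup (Fin 2) ℂ) : Matrix (Fin 2) (Fin 2) ℂ) +
              ρF L s V a.1 ν 1 • vecQuat ((((V (Site.shift (a.1.1 - Pi.single ν 1) a.1.2, ν))⁻¹ * (V (a.1.1 - Pi.single ν 1, a.1.2))⁻¹ * V (a.1.1 - Pi.single ν 1, ν))⁻¹ : Matrix.specialUnitaryGroup (Fin 2) ℂ) : Matrix (Fin 2) (Fin 2) ℂ)))‖) 2 (angle (∑ ν ∈ Finset.univ.erase a.1.2,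
            (ρF L s V a.1 ν 0 • vecQuat (((V (Site.shift a.1.1 a.1.2, ν) * (V (Site.shift a.1.1 ν, a.1.2))⁻¹ * (V (a.1.1, ν))⁻¹)⁻¹ : Matrix.specialUnitaryGroup (Fin 2) ℂ) : Matrix (Fin 2) (Fin 2) ℂ) +
              ρF L s V a.1 ν 1 • vecQuat ((((V (Site.shift (a.1.1 - Pi.single ν 1) a.1.2, ν))⁻¹ * (V (a.1.1 - Pi.single ν 1, a.1.2))⁻¹ * V (a.1.1 - Pi.single ν 1, ν))⁻¹ : Matrix.specialUnitaryGroup (Fin 2) ℂ) : Matrix (Fin 2) (Fin 2) ℂ))) (vecQuat ((V a.1 : Matrix.specialUnitaryGroup (Fin 2) ℂ) : Matrix (Fin 2) (Fin 2) ℂ)))))) ∧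
      ∃ hΦ : Measurable (fun (V : GaugeConfig d L (Matrix.specialUnitaryGroup (Fin 2) ℂ)) (l : Edge d L) => κ • WithLp.toLp 2 (fun i : Fin 3 =>
        fderiv ℝ (fun a : Edge d L → EuclideanSpace ℝ (Fin 3) => β * wilsonAction (Matrix.specialUnitaryGroup (Fin 2) ℂ).subtype ((layers.foldr (fun Ly (F : GaugeConfig d L (Matrix.specialUnitaryGroup (Fin 2) ℂ) ≃ᵐ GaugeConfig d L (Matrix.specialUnitaryGroup (Fin 2) ℂ)) => Ly.1.trans F) (MeasurableEquiv.refl (GaugeConfig d L (Matrix.specialUnitaryGroup (Fin 2) ℂ)))) ((fun l : Edge d L => expPauli (a l)) * V)) - Real.log ((layers.foldr (fun Ly K => fun v => Ly.2 v * K (Ly.1 v)) (fun _ => (1 : ℝ))) ((fun l : Edge d L => expPauli (a l)) * V))) 0 (Pi.single l (EuclideanSpace.single i (1 : ℝ))))),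
      ∀ (n : ℕ) (ε' : ℝ) (_hn : 1 ≤ n) (_hε' : 0 < ε'), n * ε' ≤ τ₀ →
        ∀ (π' : Measure (GaugeConfig d L (Matrix.specialUnitaryGroup (Fin 2) ℂ))) [IsProbabilityMeasure π'],
          Invariant (conjKernel (su2LeapfrogHMCN ε' κ' (measurable_halfKick_su2 hΦ ε')
            (fun V : GaugeConfig d L (Matrix.specialUnitaryGroup (Fin 2) ℂ) => β * wilsonAction (Matrix.specialUnitaryGroup (Fin 2) ℂ).subtype ((layers.foldr (fun Ly (F : GaugeConfig d L (Matrix.specialUnitaryGroup (Fin 2) ℂ) ≃ᵐ GaugeConfig d L (Matrix.specialUnitaryGroup (Fin 2) ℂ)) => Ly.1.trans F) (MeasurableEquiv.refl (GaugeConfig d L (Matrix.specialUnitaryGroup (Fin 2) ℂ)))) V) - Real.log ((layers.foldr (fun Ly K => fun v => Ly.2 v * K (Ly.1 v)) (fun _ => (1 : ℝ))) V)) n) (layers.foldr (fun Ly (F : GaugeConfig d L (Matrix.specialUnitaryGroup (Fin 2) ℂ) ≃ᵐ GaugeConfig d L (Matrix.specialUnitaryGroup (Fin 2) ℂ)) =>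 Ly.1.trans F) (MeasurableEquiv.refl (GaugeConfig d L (Matrix.specialUnitaryGroup (Fin 2) ℂ))))) π' →
          π' = wilsonMeasure (Matrix.specialUnitaryGroup (Fin 2) ℂ).subtype β := by
  obtain ⟨Φmax, KΦ, hΦ0, hK0, hreg⟩ := su2Residual_exactForce_regular_uniform (d := d) w μf bf cf ρF m
    hρN hρT hρL hρD hρC hρm hρloc hκ₀ hκ sched β κ
  obtain ⟨τ₀, hτ₀, huniq⟩ := su2LeapfrogFTHMCN_invariant_unique_of_trajLength_uniform hκ' hΦ0 hK0
  refine ⟨τ₀, hτ₀, fun L _ hwL => ?_⟩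
  have hχ : ∀ (x : Site d L) (i : Fin d),
      ZMod.castHom hwL (ZMod w) (∑ j, (Site.shift x i) j) ≠ ZMod.castHom hwL (ZMod w) (∑ j, x j) :=
    fun x i => phaseMask_proper hwL x i
  obtain ⟨layers, hmap, hpos, hfmeas, hfjac, hfold⟩ := su2Residual_member_package
    (fun x : Site d L => ZMod.castHom hwL (ZMod w) (∑ j, x j)) hχ μf bf cf (ρF L) (hρm L) (hρloc L hwL) hκ0 hκ₀
    (hκ L hwL) sched
  refine ⟨layers, hmap, ?_⟩
  obtain ⟨hΦm, hb, hK⟩ := hreg L hwL layers hmap hpos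
  refine ⟨hΦm, fun n ε' hn hε' hτ π' _ hπ' => ?_⟩
  have hρc : Continuous ⇑((Matrix.specialUnitaryGroup (Fin 2) ℂ).subtype) := continuous_subtype_val
  have hSc : Continuous fun U : GaugeConfig d L (Matrix.specialUnitaryGroup (Fin 2) ℂ) =>
      β * wilsonAction (Matrix.specialUnitaryGroup (Fin 2) ℂ).subtype U :=
    continuous_smul_wilsonAction _ hρc β
  obtain ⟨s, hs⟩ := exists_bound_smul_wilsonAction (d := d) (L := L) (Matrix.specialUnitaryGroup (Fin 2) ℂ).subtype hρc β
  rw [← su2GibbsLaw_eq_wilsonMeasure (d := d) (L := L) (Matrix.specialUnitaryGroup (Fin 2) ℂ).subtype β]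
  exact huniq (Edge d L) hΦm hb hK
    (S := fun U : GaugeConfig d L (Matrix.specialUnitaryGroup (Fin 2) ℂ) =>
      β * wilsonAction (Matrix.specialUnitaryGroup (Fin 2) ℂ).subtype U)
    hSc.measurable hs (pow_pos (pow_pos (by linarith) _) _) (fun v => (hfold v).1) (fun v => (hfold v).2) hfmeas hfjac
    n ε' hn hε' hτ π' hπ'

end Unique

/-! ## §2 The parity-masked family: every even torus shares the threshold -/

section Parity

variable {d : ℕ} {σ : Type*}

/-- **THE LEARNED MEMBER ON EVERY EVEN TORUS, ONE THRESHOLD.**  Any dimension `d`, parity masks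
`Σxᵢ mod 2` (classes `bf s : ZMod 2`), ANY schedule of residual layers, one conditioner on every torus
((ρN)…(ρκ)), every `β, κ, κ' > 0`: there is `τ₀ > 0` such that for EVERY even side `L` there are
`layers` (VERBATIM, weights `ρF L`) with measurable exact force, and for every `n ≥ 1`, `ε' > 0` with
`nε' ≤ τ₀` the reported `n`-step FT-HMC kernel with the exact force as run converges to
`wilsonMeasure SU(2).subtype β` from EVERY start, geometrically in total variation — the row's 4⁴
acceptance lattice and every larger even volume share `τ₀`. -/
theorem su2Residual_fthmcN_parityLattice_exactForce_uniformlyErgodic_allEvenSides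
    (μf : σ → Fin d) (bf : σ → ZMod 2) (cf : σ → ℝ)
    (ρF : ∀ M : ℕ, σ → GaugeConfig d M (Matrix.specialUnitaryGroup (Fin 2) ℂ) → Edge d M → Fin d → Fin 2 → ℝ) (m : ℕ)
    (hρN : (∀ (M M' : ℕ) (hwM : 2 ∣ M) (hMM : M ∣ M') (s : σ) (V : GaugeConfig d M (Matrix.specialUnitaryGroup (Fin 2) ℂ)) (e : Edge d M') (ν : Fin d) (t : Fin 2),
      ρF M' s (fun e : Edge d M' => V (fun i => ZMod.castHom hMM (ZMod M) (e.1 i), e.2)) e ν t =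
        ρF M s V ((fun j => ZMod.castHom hMM (ZMod M) (e.1 j)), e.2) ν t))
    (hρT : (∀ (M : ℕ) (hwM : 2 ∣ M) (t : Site d M), (∀ x : Site d M, ZMod.castHom hwM (ZMod 2) (∑ j, (x + t) j) = ZMod.castHom hwM (ZMod 2) (∑ j, x j)) →
      ∀ (s : σ) (W : GaugeConfig d M (Matrix.specialUnitaryGroup (Fin 2) ℂ)) (e : Edge d M) (ν : Fin d) (b : Fin 2),
      ρF M s (fun e : Edge d M => W (e.1 + t, e.2)) e ν b = ρF M s W (e.1 + t, e.2) ν b))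
    (hρL : (∀ (M : ℕ) (s : σ) (U U' : GaugeConfig d M (Matrix.specialUnitaryGroup (Fin 2) ℂ)) (x : Site d M) (r : ℕ),
      (∀ e : Edge d M, (∃ z : Fin d → ℤ, (∀ i, |z i| ≤ (((r+m+1) : ℕ) : ℤ)) ∧ e.1 = x + fun i => ((z i : ℤ) : ZMod M)) → U e = U' e) →
      ∀ e : Edge d M, (∃ z : Fin d → ℤ, (∀ i, |z i| ≤ ((r : ℕ) : ℤ)) ∧ e.1 = x + fun i => ((z i : ℤ) : ZMod M)) → ∀ (ν : Fin d) (t : Fin 2), ρF M s U e ν t = ρF M s U' e ν t))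
    (hρD : (∀ (M : ℕ) [NeZero M] (s : σ) (U : (Edge d M → EuclideanSpace ℝ (Fin 3)) → GaugeConfig d M (Matrix.specialUnitaryGroup (Fin 2) ℂ))
      (p₀ : Edge d M → EuclideanSpace ℝ (Fin 3)),
      (∀ e : Edge d M, DifferentiableAt ℝ (fun p => ((U p e : (Matrix.specialUnitaryGroup (Fin 2) ℂ)) : Matrix (Fin 2) (Fin 2) ℂ)) p₀) →
      ∀ (e : Edge d M) (ν : Fin d) (b : Fin 2), DifferentiableAt ℝ (fun p => ρF M s (U p) e ν b) p₀))
    (hρC : (∀ (M : ℕ) [NeZero M] {n : WithTop ℕ∞} (s : σ) (U : (Edge d M → Matrix (Fin 2) (Fin 2) ℂ) × (Edge d M → EuclideanSpace ℝ (Fin 3)) → GaugeConfig d M (Matrix.specialUnitaryGroup (Fin 2) ℂ)) (p₀ : (Edge d M → Matrix (Fin 2) (Fin 2) ℂ) × (Edge d M → EuclideanSpace ℝ (Fin 3))),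
      (∀ e : Edge d M, ContDiffAt ℝ n (fun p : (Edge d M → Matrix (Fin 2) (Fin 2) ℂ) × (Edge d M → EuclideanSpace ℝ (Fin 3)) => ((U p e : (Matrix.specialUnitaryGroup (Fin 2) ℂ)) : Matrix (Fin 2) (Fin 2) ℂ)) p₀) →
      ∀ (e : Edge d M) (ν : Fin d) (b : Fin 2), ContDiffAt ℝ n (fun p : (Edge d M → Matrix (Fin 2) (Fin 2) ℂ) × (Edge d M → EuclideanSpace ℝ (Fin 3)) => ρF M s (U p) e ν b) p₀))
    (hρm : (∀ (M : ℕ) (s : σ) (e : Edge d M) (ν : Fin d) (t : Fin 2), Measurable fun V : GaugeConfig d M (Matrix.specialUnitaryGroup (Fin 2) ℂ) => ρF M s V e ν t))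
    (hρloc : (∀ (M : ℕ) (hwM : 2 ∣ M) (s : σ) (V W : GaugeConfig d M (Matrix.specialUnitaryGroup (Fin 2) ℂ)),
      (∀ j : Edge d M, ¬(j.2 = μf s ∧ ZMod.castHom hwM (ZMod 2) (∑ i, j.1 i) = bf s) → V j = W j) →
        ∀ e : Edge d M, (e.2 = μf s ∧ ZMod.castHom hwM (ZMod 2) (∑ i, e.1 i) = bf s) → ∀ (ν : Fin d) (t : Fin 2), ρF M s V e ν t = ρF M s W e ν t))
    {κ₀ : ℝ} (hκ0 : 0 ≤ κ₀) (hκ₀ : κ₀ < 1) (hκ : (∀ (M : ℕ) (hwM : 2 ∣ M) (s : σ) (V : GaugeConfig d M (Matrix.specialUnitaryGroup (Fin 2) ℂ)) (e : Edge d M), (e.2 = μf s ∧ ZMod.castHom hwM (ZMod 2) (∑ i, e.1 i) = bf s) →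
      |cf s| * ∑ ν ∈ Finset.univ.erase e.2, (|ρF M s V e ν 0| + |ρF M s V e ν 1|) ≤ κ₀))
    (sched : List σ) (β κ : ℝ) {κ' : ℝ} (hκ' : 0 < κ') :
    ∃ τ₀ : ℝ, 0 < τ₀ ∧ ∀ (L : ℕ) [NeZero L] (hwL : 2 ∣ L),
    ∃ layers : List ((GaugeConfig d L (Matrix.specialUnitaryGroup (Fin 2) ℂ) ≃ᵐ GaugeConfig d L (Matrix.specialUnitaryGroup (Fin 2) ℂ)) × (GaugeConfig d L (Matrix.specialUnitaryGroup (Fin 2) ℂ) → ℝ)),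
      layers.map (fun Ly => ((Ly.1 : GaugeConfig d L (Matrix.specialUnitaryGroup (Fin 2) ℂ) → GaugeConfig d L (Matrix.specialUnitaryGroup (Fin 2) ℂ)), Ly.2)) =
        sched.map (fun s =>
          ((fun (V : GaugeConfig d L (Matrix.specialUnitaryGroup (Fin 2) ℂ)) (e : Edge d L) =>
        if e.2 = μf s ∧ (ZMod.castHom hwL (ZMod 2) (∑ j, e.1 j)) = bf s then
          gaussUnit (geodesicKick (cf s) (∑ ν ∈ Finset.univ.erase e.2,
            (ρF L s V e ν 0 • vecQuat (((V (Site.shift e.1 e.2, ν) * (V (Site.shift e.1 ν, e.2))⁻¹ * (V (e.1, ν))⁻¹)⁻¹ : Matrix.specialUnitaryGroup (Fin 2) ℂ) : Matrix (Fin 2) (Fin 2) ℂ) +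
              ρF L s V e ν 1 • vecQuat ((((V (Site.shift (e.1 - Pi.single ν 1) e.2, ν))⁻¹ * (V (e.1 - Pi.single ν 1, e.2))⁻¹ * V (e.1 - Pi.single ν 1, ν))⁻¹ : Matrix.specialUnitaryGroup (Fin 2) ℂ) : Matrix (Fin 2) (Fin 2) ℂ)))
            (vecQuat ((V e : Matrix.specialUnitaryGroup (Fin 2) ℂ) : Matrix (Fin 2) (Fin 2) ℂ)))
        else V e),
           fun V : GaugeConfig d L (Matrix.specialUnitaryGroup (Fin 2) ℂ) => ∏ a : {e : Edge d L // e.2 = μf s ∧ (ZMod.castHom hwL (ZMod 2) (∑ j, e.1 j)) = bf s},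
          (if Real.sin (angle (∑ ν ∈ Finset.univ.erase a.1.2,
            (ρF L s V a.1 ν 0 • vecQuat (((V (Site.shift a.1.1 a.1.2, ν) * (V (Site.shift a.1.1 ν, a.1.2))⁻¹ * (V (a.1.1, ν))⁻¹)⁻¹ : Matrix.specialUnitaryGroup (Fin 2) ℂ) : Matrix (Fin 2) (Fin 2) ℂ) +
              ρF L s V a.1 ν 1 • vecQuat ((((V (Site.shift (a.1.1 - Pi.single ν 1) a.1.2, ν))⁻¹ * (V (a.1.1 - Pi.single ν 1, a.1.2))⁻¹ * V (a.1.1 - Pi.single ν 1, ν))⁻¹ : Matrix.specialUnitaryGroup (Fin 2) ℂ) : Matrix (Fin 2) (Fin 2) ℂ))) (vecQuat ((V a.1 : Matrix.specialUnitaryGroup (Fin 2) ℂ) : Matrix (Fin 2) (Fin 2) ℂ))) = 0 then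
            (1 - cf s * ‖(∑ ν ∈ Finset.univ.erase a.1.2,
            (ρF L s V a.1 ν 0 • vecQuat (((V (Site.shift a.1.1 a.1.2, ν) * (V (Site.shift a.1.1 ν, a.1.2))⁻¹ * (V (a.1.1, ν))⁻¹)⁻¹ : Matrix.specialUnitaryGroup (Fin 2) ℂ) : Matrix (Fin 2) (Fin 2) ℂ) +
              ρF L s V a.1 ν 1 • vecQuat ((((V (Site.shift (a.1.1 - Pi.single ν 1) a.1.2, ν))⁻¹ * (V (a.1.1 - Pi.single ν 1, a.1.2))⁻¹ * V (a.1.1 - Pi.single ν 1, ν))⁻¹ : Matrix.specialUnitaryGroup (Fin 2) ℂ) : Matrix (Fin 2) (Fin 2) ℂ)))‖ * Real.cos (angle (∑ ν ∈ Finset.univ.erase a.1.2,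
            (ρF L s V a.1 ν 0 • vecQuat (((V (Site.shift a.1.1 a.1.2, ν) * (V (Site.shift a.1.1 ν, a.1.2))⁻¹ * (V (a.1.1, ν))⁻¹)⁻¹ : Matrix.specialUnitaryGroup (Fin 2) ℂ) : Matrix (Fin 2) (Fin 2) ℂ) +
              ρF L s V a.1 ν 1 • vecQuat ((((V (Site.shift (a.1.1 - Pi.single ν 1) a.1.2, ν))⁻¹ * (V (a.1.1 - Pi.single ν 1, a.1.2))⁻¹ * V (a.1.1 - Pi.single ν 1, ν))⁻¹ : Matrix.specialUnitaryGroup (Fin 2) ℂ) : Matrix (Fin 2) (Fin 2) ℂ))) (vecQuat ((V a.1 : Matrix.specialUnitaryGroup (Fin 2) ℂ) : Matrix (Fin 2) (Fin 2) ℂ)))) ^ 3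
          else kickJac (cf s * ‖(∑ ν ∈ Finset.univ.erase a.1.2,
            (ρF L s V a.1 ν 0 • vecQuat (((V (Site.shift a.1.1 a.1.2, ν) * (V (Site.shift a.1.1 ν, a.1.2))⁻¹ * (V (a.1.1, ν))⁻¹)⁻¹ : Matrix.specialUnitaryGroup (Fin 2) ℂ) : Matrix (Fin 2) (Fin 2) ℂ) +
              ρF L s V a.1 ν 1 • vecQuat ((((V (Site.shift (a.1.1 - Pi.single ν 1) a.1.2, ν))⁻¹ * (V (a.1.1 - Pi.single ν 1, a.1.2))⁻¹ * V (a.1.1 - Pi.single ν 1, ν))⁻¹ : Matrix.specialUnitaryGroup (Fin 2) ℂ) : Matrix (Fin 2) (Fin 2) ℂ)))‖) 2 (angle (∑ ν ∈ Finset.univ.erase a.1.2,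
            (ρF L s V a.1 ν 0 • vecQuat (((V (Site.shift a.1.1 a.1.2, ν) * (V (Site.shift a.1.1 ν, a.1.2))⁻¹ * (V (a.1.1, ν))⁻¹)⁻¹ : Matrix.specialUnitaryGroup (Fin 2) ℂ) : Matrix (Fin 2) (Fin 2) ℂ) +
              ρF L s V a.1 ν 1 • vecQuat ((((V (Site.shift (a.1.1 - Pi.single ν 1) a.1.2, ν))⁻¹ * (V (a.1.1 - Pi.single ν 1, a.1.2))⁻¹ * V (a.1.1 - Pi.single ν 1, ν))⁻¹ : Matrix.specialUnitaryGroup (Fin 2) ℂ) : Matrix (Fin 2) (Fin 2) ℂ))) (vecQuat ((V a.1 : Matrix.specialUnitaryGroup (Fin 2) ℂ) : Matrix (Fin 2) (Fin 2) ℂ)))))) ∧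
      ∃ hΦ : Measurable (fun (V : GaugeConfig d L (Matrix.specialUnitaryGroup (Fin 2) ℂ)) (l : Edge d L) => κ • WithLp.toLp 2 (fun i : Fin 3 =>
        fderiv ℝ (fun a : Edge d L → EuclideanSpace ℝ (Fin 3) => β * wilsonAction (Matrix.specialUnitaryGroup (Fin 2) ℂ).subtype ((layers.foldr (fun Ly (F : GaugeConfig d L (Matrix.specialUnitaryGroup (Fin 2) ℂ) ≃ᵐ GaugeConfig d L (Matrix.specialUnitaryGroup (Fin 2) ℂ)) => Ly.1.trans F) (MeasurableEquiv.refl (GaugeConfig d L (Matrix.specialUnitaryGroup (Fin 2) ℂ)))) ((fun l : Edge d L => expPauli (a l)) * V)) - Real.log ((layers.foldr (fun Ly K => fun v => Ly.2 v * K (Ly.1 v)) (fun _ => (1 : ℝ))) ((fun l : Edge d L => expPauli (a l)) * V))) 0 (Pi.single l (EuclideanSpace.single i (1 : ℝ))))),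
      ∀ (n : ℕ) (ε' : ℝ) (_hn : 1 ≤ n) (_hε' : 0 < ε'), n * ε' ≤ τ₀ →
        ∃ k : ℕ, ∃ δ : ℝ, 0 < δ ∧ δ ≤ 1 ∧ ∀ (μ₀ : Measure (GaugeConfig d L (Matrix.specialUnitaryGroup (Fin 2) ℂ))) [IsProbabilityMeasure μ₀] (t : ℕ) (A : Set (GaugeConfig d L (Matrix.specialUnitaryGroup (Fin 2) ℂ))),
          |((fun m : Measure (GaugeConfig d L (Matrix.specialUnitaryGroup (Fin 2) ℂ)) =>
                m.bind (conjKernel (su2LeapfrogHMCN ε' κ' (measurable_halfKick_su2 hΦ ε')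
                  (fun V : GaugeConfig d L (Matrix.specialUnitaryGroup (Fin 2) ℂ) => β * wilsonAction (Matrix.specialUnitaryGroup (Fin 2) ℂ).subtype ((layers.foldr (fun Ly (F : GaugeConfig d L (Matrix.specialUnitaryGroup (Fin 2) ℂ) ≃ᵐ GaugeConfig d L (Matrix.specialUnitaryGroup (Fin 2) ℂ)) => Ly.1.trans F) (MeasurableEquiv.refl (GaugeConfig d L (Matrix.specialUnitaryGroup (Fin 2) ℂ)))) V) - Real.log ((layers.foldr (fun Ly K => fun v => Ly.2 v * K (Ly.1 v)) (fun _ => (1 : ℝ))) V)) n) (layers.foldr (fun Ly (F : GaugeConfig d L (Matrix.specialUnitaryGroup (Fin 2) ℂ) ≃ᵐ GaugeConfig d L (Matrix.specialUnitaryGroup (Fin 2) ℂ)) => Ly.1.trans F) (MeasurableEquiv.refl (GaugeConfig d L (Matrix.specialUnitaryGroup (Fin 2) ℂ))))))^[t] μ₀).real A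
            - (wilsonMeasure (Matrix.specialUnitaryGroup (Fin 2) ℂ).subtype β).real A| ≤ (1 - δ) ^ (t / (k + 1)) := by
  haveI : Fact (1 < 2) := ⟨by norm_num⟩
  obtain ⟨τ₀, hτ₀, h⟩ := su2Residual_member_fthmcN_exactForce_uniformlyErgodic_allVolumes (d := d) 2 μf bf cf ρF m
    hρN hρT hρL hρD hρC hρm hρloc hκ0 hκ₀ hκ sched β κ hκ'
  refine ⟨τ₀, hτ₀, fun L _ hwL => ?_⟩
  exact h L hwL

end Parity

end Summit.Ventures.LatticeQCDFlow.Exactness
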